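import Summits.Ventures.CertifiedManyBodySolver.Certificates.SymRungV0core.Data.Hdr0
import Summits.Ventures.CertifiedManyBodySolver.Certificates.SymRungV0core.Data.Hdr1
import Summits.Ventures.CertifiedManyBodySolver.Certificates.SymRungV0core.Data.Hdr2
import Summits.Ventures.CertifiedManyBodySolver.Certificates.SymRungV0core.Data.Hdr3
import Summits.Ventures.CertifiedManyBodySolver.Certificates.SymRungV0core.Data.Hdr4
import Summits.Ventures.CertifiedManyBodySolver.Certificates.SymRungV0core.Data.Hdr5
import Summits.Ventures.CertifiedManyBodySolver.Certificates.SymRungV0core.Data.Hdr6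
import Summits.Ventures.CertifiedManyBodySolver.Certificates.SymRungV0core.Data.Hdr7
import Summits.Ventures.CertifiedManyBodySolver.Certificates.SymRungV0core.Data.Hdr8
import Summits.Ventures.CertifiedManyBodySolver.Certificates.SymRungV0core.Data.Hdr9
import Summits.Ventures.CertifiedManyBodySolver.Certificates.SymRungV0core.Data.Hdr10
import Summits.Ventures.CertifiedManyBodySolver.Certificates.SymRungV0core.Data.GramR0
import Summits.Ventures.CertifiedManyBodySolver.Certificates.SymRungV0core.Data.GramR1
import Summits.Ventures.CertifiedManyBodySolver.Certificates.SymRungV0core.Data.GramR2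
import Summits.Ventures.CertifiedManyBodySolver.Certificates.SymRungV0core.Data.GramR3
import Summits.Ventures.CertifiedManyBodySolver.Certificates.SymRungV0core.Data.GramR4
import Summits.Ventures.CertifiedManyBodySolver.Certificates.SymRungV0core.Data.GramR5
import Summits.Ventures.CertifiedManyBodySolver.Certificates.SymRungV0core.Data.GramR6
import Summits.Ventures.CertifiedManyBodySolver.Certificates.SymRungV0core.Data.GramR7
import Summits.Ventures.CertifiedManyBodySolver.Certificates.SymRungV0core.Data.P0c0
import Summits.Ventures.CertifiedManyBodySolver.Certificates.SymRungV0core.Data.P0c1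
import Summits.Ventures.CertifiedManyBodySolver.Certificates.SymRungV0core.Data.P0c2
import Summits.Ventures.CertifiedManyBodySolver.Certificates.SymRungV0core.Data.P0c3
import Summits.Ventures.CertifiedManyBodySolver.Certificates.SymRungV0core.Data.P0c4
import Summits.Ventures.CertifiedManyBodySolver.Certificates.SymRungV0core.Data.P0c5
import Summits.Ventures.CertifiedManyBodySolver.Certificates.SymRungV0core.Data.P0c6
import Summits.Ventures.CertifiedManyBodySolver.Certificates.SymRungV0core.Data.P0c7
import Summits.Ventures.CertifiedManyBodySolver.Certificates.SymRungV0core.Data.P0c8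
import Summits.Ventures.CertifiedManyBodySolver.Certificates.SymRungV0core.Data.P1c0
import Summits.Ventures.CertifiedManyBodySolver.Certificates.SymRungV0core.Data.P1c1
import Summits.Ventures.CertifiedManyBodySolver.Certificates.SymRungV0core.Data.P1c2
import Summits.Ventures.CertifiedManyBodySolver.Certificates.SymRungV0core.Data.P1c3
import Summits.Ventures.CertifiedManyBodySolver.Certificates.SymRungV0core.Data.P1c4
import Summits.Ventures.CertifiedManyBodySolver.Certificates.SymRungV0core.Data.P1c5
import Summits.Ventures.CertifiedManyBodySolver.Certificates.SymRungV0core.Data.P1c6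
import Summits.Ventures.CertifiedManyBodySolver.Certificates.SymRungV0core.Data.P1c7
import Summits.Ventures.CertifiedManyBodySolver.Certificates.SymRungV0core.Data.P2c0
import Summits.Ventures.CertifiedManyBodySolver.Certificates.SymRungV0core.Data.P2c1
import Summits.Ventures.CertifiedManyBodySolver.Certificates.SymRungV0core.Data.P2c2
import Summits.Ventures.CertifiedManyBodySolver.Certificates.SymRungV0core.Data.P2c3
import Summits.Ventures.CertifiedManyBodySolver.Certificates.SymRungV0core.Data.P2c4
import Summits.Ventures.CertifiedManyBodySolver.Certificates.SymRungV0core.Data.P2c5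
import Summits.Ventures.CertifiedManyBodySolver.Certificates.SymRungV0core.Data.P2c6
import Summits.Ventures.CertifiedManyBodySolver.Certificates.SymRungV0core.Data.P2c7
import Summits.Ventures.CertifiedManyBodySolver.Certificates.SymRungV0core.Data.P2c8
import Summits.Ventures.CertifiedManyBodySolver.Theorems.M3x2EdgeSplitSymReplayDecodeV2
import Summits.Ventures.CertifiedManyBodySolver.Theorems.M3x2EdgeSplitSymReplayGramRDecode
import Summits.Ventures.CertifiedManyBodySolver.Theorems.M3x2EdgeSplitSymReplayBoxCanon

/-!
# Rung V = v0′ (CORE) — certificate record, partials and cheap facts (lander hub-lb-sym-eng-4 g1; crit-1 V116/V119 PLAN v0′-B)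
The v0′ window certificate of the lb-sym ladder (value `symValueR = −270273895186422731696475/2⁷⁸ = −0.8942613047`, round-before-lift
K 40 by hub-lb-sym-eng-1 g1, comp JSON `v0core_rbl_K40.rev7_comp.symcert2.json.gz` sha256 a27af62beaea50b5…) as an R-certificate
`cert : SymCertR`: header slots decoded from the v2 token chunks `hdr0…hdr10` (`decodeSymCertV2`, Theorems…DecodeV2), the Gram part as 85
orbit-representative R-blocks from `gramR0…gramR7` (`decodeGramR`, Theorems…GramRDecode; J = 3 LPT order of record, hub-lb-sym-ref-2 g1),
and the three shipped shard PARTIALS of the Gram groups (`p0c*`, `p1c*`, `p2c*`, read by `rdSlotPolys`) with the base-shard partial CLOSED as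
`Pbase := −collect (Pg0 ++ Pg1 ++ Pg2)` (rule (D)).  Closing shape: `energyDensity_ge_of_shardsRGB` (Theorems…BoxCanon) with box licence
`[−12,12]²`, `c = 6`, `sizes = [26, 29]` (groups of 26/29/30 blocks).  No bound of record moves by this module (#529 −0.8295699476 stays the certified row); the rung value −0.8942613 is 0.064 BELOW the −83/100 edge (stmt-Ventures-22024 NOT closed); computational grade (`native_decide`); no summit or crux statement is proved here; nothing here predicts superconductivity.
-/

namespace Summit.Ventures.CertifiedManyBodySolver.Certificates.SymRungV0core

open Summit.Ventures.CertifiedManyBodySolver.Theorems.SymReplay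

/-- Header tokens (v2 grammar). -/
def hdrToks : Toks := toksOf [hdr0, hdr1, hdr2, hdr3, hdr4, hdr5, hdr6, hdr7, hdr8, hdr9, hdr10]

/-- Gram R-block tokens (GramRDecode grammar). -/
def gramRToks : Toks := toksOf [gramR0, gramR1, gramR2, gramR3, gramR4, gramR5, gramR6, gramR7]

/-- **The v0′ R-certificate.** -/
def cert : SymCertR := { toSymCert := decodeSymCertV2 hdrToks, gramR := decodeGramR gramRToks }

/-- Box licence corners: the frame is `[−12,12]²`. -/
def lo : ℤ × ℤ := ((-12 : ℤ), (-12 : ℤ))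

/-- Box licence corners: the frame is `[−12,12]²`. -/
def hi : ℤ × ℤ := ((12 : ℤ), (12 : ℤ))

/-- Product-chunk parameter of the R-shards (term order only). -/
def cpar : ℕ := 6

/-- J = 3 Gram groups: the first two group lengths (the third is the remainder, 30 blocks). -/
def sizes : List ℕ := [26, 29]

/-- Shipped partial of Gram group 0 (v2 slot-polys tokens). -/
def Pg0 : QPoly := ((rdSlotPolys (siteTab cert.frame) (toksOf [p0c0, p0c1, p0c2, p0c3, p0c4, p0c5, p0c6, p0c7, p0c8])).1).headD []

/-- Shipped partial of Gram group 1. -/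
def Pg1 : QPoly := ((rdSlotPolys (siteTab cert.frame) (toksOf [p1c0, p1c1, p1c2, p1c3, p1c4, p1c5, p1c6, p1c7])).1).headD []

/-- Shipped partial of Gram group 2. -/
def Pg2 : QPoly := ((rdSlotPolys (siteTab cert.frame) (toksOf [p2c0, p2c1, p2c2, p2c3, p2c4, p2c5, p2c6, p2c7, p2c8])).1).headD []

/-- The base-shard partial, CLOSED by construction (rule (D)): minus the collected sum of the group partials. -/
def Pbase : QPoly := pscale (-1) (collect ([Pg0, Pg1, Pg2].flatten))

/-- The partials in shard order (base, group 0, group 1, group 2). -/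
def Ps : List QPoly := [Pbase, Pg0, Pg1, Pg2]

/-- The header token stream decodes without leftover tokens. -/
theorem hdr_rest : decodeRestV2 hdrToks = 0 := by native_decide

/-- The R-block token stream decodes without leftover tokens. -/
theorem gramR_rest : decodeGramRRest gramRToks = 0 := by native_decide

/-- The frame IS the integer box `[−12,12]²` (box licence). -/
theorem hbox : boxLicence cert.frame lo hi = true := by native_decide

/-- 85 R-blocks. -/
theorem hlen : cert.gramR.length = 85 := by native_decide

/-- Four shards: base + three Gram groups. -/
theorem hcount : shardCountRG cert cpar sizes = Ps.length := by native_decide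

/-- Partial sizes (terms): group partials and the closed base partial. -/
theorem partial_lengths : (Pg0.length, Pg1.length, Pg2.length) = (35563, 32870, 35556) := by native_decide

/-- The certified value, evaluated. -/
theorem cert_value : symValueR cert = ((-270273895186422731696475 : ℚ) / 302231454903657293676544) := by native_decide

end Summit.Ventures.CertifiedManyBodySolver.Certificates.SymRungV0core
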